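import Summits.ResolutionOfSingularities.ResolutionOfSingularities.Theorems.FrobeniusLadderFInjectiveMacaulayficationAffineBlowupChartFrame
import Summits.ResolutionOfSingularities.ResolutionOfSingularities.Theorems.FrobeniusLadderFInjectiveMacaulayficationFibreIdealOfOrigin
import Summits.ResolutionOfSingularities.ResolutionOfSingularities.Theorems.FrobeniusLadderFInjectiveMacaulayficationBlowupFiModelOfCover
import HarnessLib

/-!
# [OURS · L1 W4.5a] E7 `AffineBlowupChartTransport` — (i) the chart clause moves along ring isomorphisms of the chart ring, with its
# guards; (ii) the Rees charts' OVERLAPS `D₊(x_σ t) ⊓ D₊(x_τ t) = D(x_τ/x_σ)` read through the sections isomorphism; (iii) the fibre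
# ideal of a base point read in `R[I/a]`

Crux `FrobeniusLadder.FInjectiveMacaulayfication` = stmt-ResolutionOfSingularities-15315 (chain w45a), hole 5e, E7 instance layer
(res-L1-w45a-plan-1 RULING R13.3 (B) 2026-08-27T11:39:51Z adopting res-L1-w45a-lead-1's proposal 11:36:09Z: «`AffineBlowupChartTransport`
(def-free sibling of N5a): (i) `chartClause_transport`, (ii) Rees-chart OVERLAP, (iii) `J.ideal (U σ)` / `𝔟 σ` images under `e`»).
Helper `--supports stmt-ResolutionOfSingularities-15315 --as helper`, typed by res-type-034. OURS: replaces the role of NOTHING in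
H. Hironaka's manuscript and is NOT a statement of it; AI-written kernel glue of the cell `res-hironaka`, weaker than expert review. No
definition, no named fact.

THE POINT. Level 1 of the T₁₁/3 two-level tower is N5d `TwoLevelTowerLevelOne.stalkClause_off_support_of_chartClauses` (p527958), whose
binder `hchart : ∀ c (Q : Ideal Γ(X′, U c)) [Q.IsMaximal], ¬ J₂.ideal (U c) ≤ Q → 𝔟 c ≤ Q → CLAUSE(Γ(X′, U c)_Q)` lives on the SECTIONS
of the Rees charts `U σ = D₊(x_σ t)` of `X′ = Bl_I(Spec R) = affineBlowup I`, while the certificates (cells, CN engine) live on the affine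
blow-up algebras `R[I/x_σ] = blowupAlgebra I (x σ)` (N5a `AffineBlowupChartFrame.exists_sectionsEquiv_blowupAlgebra`: `e : Γ(X′, U σ) ≃+*
R[I/x_σ]`, `e (π^* r) = r/1`) or on a further model `ε : R[I/x_σ] ≃+* k[y]/(g_σ)` (C1 presentations). This file supplies:
* §1 (i) — ANY rings, `f : A ≃+* B` (use `f = e.trans ε`): `map_le_map_iff_of_ringEquiv` (`J·f ≤ Q·f ↔ J ≤ Q`), `map_trans`
  (`J·(e ≫ ε) = (J·e)·ε`), the clause at `A_Q` from the clause at `B_{Q·f}` (`clause_atPrime_of_ringEquiv`, FULL form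
  `fiClause_atPrime_of_ringEquiv`: `BlowupFiModelOfCover.nonempty_ringEquiv_localization_of_ringEquiv` + `DegreeZeroDescent.inlineClause_of_ringEquiv`
  + `MulEquiv.isDomain`),
  and **`chartClause_transport`**: N5d's `hchart` shape on `A` from the same shape on `B` with EQUATION-STYLE guard binders
  `J·f = J″`, `𝔟·f = 𝔟″` (maximality moves by `Ideal.map_isMaximal_of_equiv`);
* §2 (ii) — the Rees chart `D₊(at)` of `Bl_I(Spec R)` with ITS canonical sections isomorphism PINNED: `exists_sectionsEquiv_eq` gives
  `e` with `e ∘ (Proj.basicOpenIsoAway …).hom = reesChartEquiv` (N5a's construction, now exposed as a property, since an arbitrary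
  `R`-compatible `e` does NOT determine basic opens); from that property: the compatibility `e (π^* r) = r/1` (`compat_of_sectionsEquiv_eq`),
  the POINT reading `e⁻¹(x/(at)ⁿ) ∈ 𝔭_y ↔ x ∈ y` (`symm_mk_mem_primeIdealOf_iff`, via the tree's `Proj.mk_mem_basicOpenToSpec_apply`), and
  the OVERLAP **`(affineBlowup I).basicOpen (e⁻¹(b/a)) = D₊(at) ⊓ D₊(bt)`** (`basicOpen_symm_div_eq_inf`; Mathlib's `Proj.awayι_preimage_basicOpen`
  is the same fact in `Spec`-currency), and the BEZOUT step `exists_mem_basicOpen_of_span_sup_map_eq_top` / `exists_mem_basicOpen_of_mem_support`: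
  `(b_i/a)_i + (J.ideal D₊(at))·e = R[I/a]` and `y ∈ supp J ∩ D₊(at)` ⇒ `y ∈ D₊(b_i t)` for some `i` — the cert's cover certificates ⇒ N4′'s `hcover`;
* §3 (iii) — the FIBRE IDEAL of a base point `b ∈ Spec R` on the chart (N4b currency `𝔭_b·Γ(X′, U)`, res-type-002
  `FibreIdealOfBasePoint`/`FibreIdealOfOrigin`) read in `R[I/a]`: **`(𝔭_b·Γ(X′, D₊(at)))·e = 𝔭_b·R[I/a]`** (`map_fibreIdeal_eq`) and the
  generators form `= (x_j/1)_j` (`map_fibreIdeal_eq_span`); the round trip `(J·e)·e⁻¹ = J` is Mathlib `Ideal.comap_map_of_bijective`.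
References: Mathlib `AlgebraicGeometry.ProjectiveSpectrum.Basic` (`Proj.basicOpenIsoAway`, `Proj.awayToSection`, `Proj.basicOpenToSpec`,
`Proj.awayι_preimage_basicOpen`), `AlgebraicGeometry.AffineScheme` (`IsAffineOpen.primeIdealOf`, `isoSpec_hom`, `fromSpec_preimage_basicOpen`);
the tree's `AffineBlowup` (`Proj.mk_mem_basicOpenToSpec_apply`), `AffineBlowupAlgebra` (`reesChartEquiv`, `reesChart_mk`); The Stacks Project,
Tag 0804 (`D₊(a^{(1)}) = Spec R[I/a]`, overlaps of the affine blow-up charts) — background; folklore.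
-/

-- single-problem summit: the doubled namespace component is forced
set_option linter.dupNamespace false

noncomputable section

open AlgebraicGeometry CategoryTheory TopologicalSpace HomogeneousLocalization
open Literature.AlgebraicGeometry.Resolution
open Summit.ResolutionOfSingularities.ResolutionOfSingularities.Theorems.FInjectiveMacaulayfication

namespace Summit.ResolutionOfSingularities.ResolutionOfSingularities.Theorems.FInjectiveMacaulayfication.AffineBlowupChartTransport

/-! ## §1 (i) The chart clause and its guards move along a ring isomorphism -/

section Transport

universe u v w

/-- `J·f ≤ Q·f ↔ J ≤ Q` for a ring isomorphism `f`. [folklore] -/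
theorem map_le_map_iff_of_ringEquiv {A : Type u} {B : Type v} [CommRing A] [CommRing B] (f : A ≃+* B) {J Q : Ideal A} :
    J.map f ≤ Q.map f ↔ J ≤ Q := by
  refine ⟨fun h x hx => ?_, fun h => Ideal.map_mono h⟩
  exact Ideal.apply_mem_of_equiv_iff.mp (h (Ideal.mem_map_of_mem f hx))

/-- `J·(e ≫ ε) = (J·e)·ε` for ring isomorphisms `e`, `ε` (two-step transport: N5a's `e` followed by a chart presentation `ε`). [folklore] -/
theorem map_trans {A : Type u} {B : Type v} {C : Type w} [CommRing A] [CommRing B] [CommRing C] (e : A ≃+* B) (ε : B ≃+* C)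
    (J : Ideal A) : J.map (e.trans ε) = (J.map e).map ε := by
  apply le_antisymm
  · rw [Ideal.map_le_iff_le_comap]
    intro x hx
    rw [Ideal.mem_comap]
    exact Ideal.mem_map_of_mem ε (Ideal.mem_map_of_mem e hx)
  · rw [Ideal.map_le_iff_le_comap, Ideal.map_le_iff_le_comap]
    intro x hx
    rw [Ideal.mem_comap, Ideal.mem_comap]
    exact Ideal.mem_map_of_mem (e.trans ε) hx

/-- **The Cohen–Macaulay + Frobenius-closed clause at `A_Q` from the clause at `B_{Q·f}`**, `f : A ≃+* B`, `Q` prime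
(`A_Q ≅ B_{Q·f}`: `BlowupFiModelOfCover.nonempty_ringEquiv_localization_of_ringEquiv`; `DegreeZeroDescent.inlineClause_of_ringEquiv`). [folklore] -/
theorem clause_atPrime_of_ringEquiv (p : ℕ) {A B : Type} [CommRing A] [CommRing B] (f : A ≃+* B) (Q : Ideal A) [Q.IsPrime]
    (h : ∀ d : ℕ, ringKrullDim (Localization.AtPrime (Q.map f)) = d → ∀ s : Fin d → Localization.AtPrime (Q.map f),
      (Ideal.span (Set.range s)).radical.IsMaximal →
        RingTheory.Sequence.IsWeaklyRegular (Localization.AtPrime (Q.map f)) (List.ofFn s) ∧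
        ∀ y : Localization.AtPrime (Q.map f), (∃ n : ℕ, y ^ p ^ n ∈ Ideal.span
          ((fun z : Localization.AtPrime (Q.map f) => z ^ p ^ n) ''
            (Ideal.span (Set.range s) : Set (Localization.AtPrime (Q.map f))))) → y ∈ Ideal.span (Set.range s)) :
    ∀ d : ℕ, ringKrullDim (Localization.AtPrime Q) = d → ∀ s : Fin d → Localization.AtPrime Q,
      (Ideal.span (Set.range s)).radical.IsMaximal →
        RingTheory.Sequence.IsWeaklyRegular (Localization.AtPrime Q) (List.ofFn s) ∧
        ∀ y : Localization.AtPrime Q, (∃ n : ℕ, y ^ p ^ n ∈ Ideal.span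
          ((fun z : Localization.AtPrime Q => z ^ p ^ n) ''
            (Ideal.span (Set.range s) : Set (Localization.AtPrime Q)))) → y ∈ Ideal.span (Set.range s) := by
  obtain ⟨eL⟩ := BlowupFiModelOfCover.nonempty_ringEquiv_localization_of_ringEquiv f Q (Q.map f)
    fun x => Ideal.apply_mem_of_equiv_iff
  exact DegreeZeroDescent.inlineClause_of_ringEquiv p eL.symm h

/-- The FULL clause (domain conjunct included) at `A_Q` from the FULL clause at `B_{Q·f}`. [folklore] -/
theorem fiClause_atPrime_of_ringEquiv (p : ℕ) {A B : Type} [CommRing A] [CommRing B] (f : A ≃+* B) (Q : Ideal A) [Q.IsPrime]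
    (h : IsDomain (Localization.AtPrime (Q.map f)) ∧
      ∀ d : ℕ, ringKrullDim (Localization.AtPrime (Q.map f)) = d → ∀ s : Fin d → Localization.AtPrime (Q.map f),
        (Ideal.span (Set.range s)).radical.IsMaximal →
          RingTheory.Sequence.IsWeaklyRegular (Localization.AtPrime (Q.map f)) (List.ofFn s) ∧
          ∀ y : Localization.AtPrime (Q.map f), (∃ n : ℕ, y ^ p ^ n ∈ Ideal.span
            ((fun z : Localization.AtPrime (Q.map f) => z ^ p ^ n) ''
              (Ideal.span (Set.range s) : Set (Localization.AtPrime (Q.map f))))) → y ∈ Ideal.span (Set.range s)) :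
    IsDomain (Localization.AtPrime Q) ∧ ∀ d : ℕ, ringKrullDim (Localization.AtPrime Q) = d → ∀ s : Fin d → Localization.AtPrime Q,
      (Ideal.span (Set.range s)).radical.IsMaximal →
        RingTheory.Sequence.IsWeaklyRegular (Localization.AtPrime Q) (List.ofFn s) ∧
        ∀ y : Localization.AtPrime Q, (∃ n : ℕ, y ^ p ^ n ∈ Ideal.span
          ((fun z : Localization.AtPrime Q => z ^ p ^ n) ''
            (Ideal.span (Set.range s) : Set (Localization.AtPrime Q)))) → y ∈ Ideal.span (Set.range s) := by
  obtain ⟨eL⟩ := BlowupFiModelOfCover.nonempty_ringEquiv_localization_of_ringEquiv f Q (Q.map f)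
    fun x => Ideal.apply_mem_of_equiv_iff
  haveI := h.1
  exact ⟨MulEquiv.isDomain _ eL.toMulEquiv, DegreeZeroDescent.inlineClause_of_ringEquiv p eL.symm h.2⟩

/-- **(i) `chartClause_transport` — N5d's `hchart` shape moves along a ring isomorphism `f : A ≃+* B` of the chart ring.** With
EQUATION-STYLE guard binders `J·f = J″` (the level-2 centre on the chart) and `𝔟·f = 𝔟″` (the fibre ideal): the clause at the maximal
ideals `Q″` of `B` with `¬ J″ ≤ Q″`, `𝔟″ ≤ Q″` gives the clause at the maximal ideals `Q` of `A` with `¬ J ≤ Q`, `𝔟 ≤ Q`. For the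
T₁₁/3 instance: `A = Γ(affineBlowup I, U σ)`, `f = e.trans ε` (N5a's `e`, then the chart presentation `ε`), so cell-level clauses on
`k[y]/(g_σ)` feed N5d's `hchart` (and N4/N4′'s `hoff`). [folklore] -/
theorem chartClause_transport (p : ℕ) {A B : Type} [CommRing A] [CommRing B] (f : A ≃+* B) (J 𝔟 : Ideal A) (J'' 𝔟'' : Ideal B)
    (hJ : J.map f = J'') (h𝔟 : 𝔟.map f = 𝔟'')
    (hB : ∀ (Q'' : Ideal B) [Q''.IsMaximal], ¬ J'' ≤ Q'' → 𝔟'' ≤ Q'' →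
      ∀ d : ℕ, ringKrullDim (Localization.AtPrime Q'') = d → ∀ s : Fin d → Localization.AtPrime Q'',
        (Ideal.span (Set.range s)).radical.IsMaximal →
          RingTheory.Sequence.IsWeaklyRegular (Localization.AtPrime Q'') (List.ofFn s) ∧
          ∀ y : Localization.AtPrime Q'', (∃ n : ℕ, y ^ p ^ n ∈ Ideal.span
            ((fun z : Localization.AtPrime Q'' => z ^ p ^ n) ''
              (Ideal.span (Set.range s) : Set (Localization.AtPrime Q'')))) → y ∈ Ideal.span (Set.range s)) :
    ∀ (Q : Ideal A) [Q.IsMaximal], ¬ J ≤ Q → 𝔟 ≤ Q →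
      ∀ d : ℕ, ringKrullDim (Localization.AtPrime Q) = d → ∀ s : Fin d → Localization.AtPrime Q,
        (Ideal.span (Set.range s)).radical.IsMaximal →
          RingTheory.Sequence.IsWeaklyRegular (Localization.AtPrime Q) (List.ofFn s) ∧
          ∀ y : Localization.AtPrime Q, (∃ n : ℕ, y ^ p ^ n ∈ Ideal.span
            ((fun z : Localization.AtPrime Q => z ^ p ^ n) ''
              (Ideal.span (Set.range s) : Set (Localization.AtPrime Q)))) → y ∈ Ideal.span (Set.range s) := by
  subst hJ h𝔟
  intro Q _ hJQ hbQ
  haveI : (Q.map f).IsMaximal := Ideal.map_isMaximal_of_equiv f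
  exact clause_atPrime_of_ringEquiv p f Q (hB (Q.map f) (fun hle => hJQ ((map_le_map_iff_of_ringEquiv f).mp hle))
    ((map_le_map_iff_of_ringEquiv f).mpr hbQ))

end Transport

/-! ## §2 (ii) The Rees chart `D₊(at)` with its canonical sections isomorphism pinned; points and overlaps -/

section ReesChart

universe u

variable {R : Type u} [CommRing R] (I : Ideal R) (a : R) (ha : a ∈ I)

/-- A section lies in the prime of a point iff the point is not in its basic open: `s ∈ 𝔭_x ↔ x ∉ D(s)` (any scheme, any affine open;
`fromSpec 𝔭_x = x` and `fromSpec⁻¹ D(s) = D(s) ⊆ Spec Γ(X, U)`). [folklore] -/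
theorem mem_primeIdealOf_iff_not_mem_basicOpen {X : Scheme.{u}} (U : X.affineOpens) {x : X} (hx : x ∈ (U : X.Opens))
    (s : Γ(X, U)) : s ∈ (U.2.primeIdealOf ⟨x, hx⟩).asIdeal ↔ x ∉ X.basicOpen s := by
  have hfs : U.2.fromSpec.base (U.2.primeIdealOf ⟨x, hx⟩) = x := U.2.fromSpec_primeIdealOf ⟨x, hx⟩
  constructor
  · intro hs hxD
    have h1 : U.2.primeIdealOf ⟨x, hx⟩ ∈ U.2.fromSpec ⁻¹ᵁ X.basicOpen s := by
      show U.2.fromSpec.base (U.2.primeIdealOf ⟨x, hx⟩) ∈ X.basicOpen s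
      rw [hfs]; exact hxD
    rw [U.2.fromSpec_preimage_basicOpen] at h1
    exact (PrimeSpectrum.mem_basicOpen (f := s) _).mp h1 hs
  · intro hxD
    by_contra hs
    apply hxD
    have h1 : U.2.primeIdealOf ⟨x, hx⟩ ∈ U.2.fromSpec ⁻¹ᵁ X.basicOpen s := by
      rw [U.2.fromSpec_preimage_basicOpen]
      exact (PrimeSpectrum.mem_basicOpen (f := s) _).mpr hs
    have h2 : U.2.fromSpec.base (U.2.primeIdealOf ⟨x, hx⟩) ∈ X.basicOpen s := h1
    rwa [hfs] at h2

/-- **The canonical sections isomorphism of the Rees chart, PINNED.** There is `e : Γ(Bl_I(Spec R), D₊(at)) ≃+* R[I/a]` with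
`e ∘ (Proj.basicOpenIsoAway …).hom = reesChartEquiv` on `(R[It])_{(at)}` — N5a's construction (Mathlib's `(A_f)₀ ≅ Γ(Proj, D₊(f))`
followed by the tree's `(R[It])_{(at)} ≃+* R[I/a]`), exposed as a characterising property from which the compatibility with `π^*`,
the point reading and the overlaps below follow. [folklore; OURS glue] -/
theorem exists_sectionsEquiv_eq :
    ∃ e : Γ(affineBlowup I, Proj.basicOpen (reesGrading I) (reesT a ha)) ≃+* blowupAlgebra I a,
      ∀ g : Away (reesGrading I) (reesT a ha),
        e ((Proj.basicOpenIsoAway (reesGrading I) (reesT a ha) (reesT_mem a ha) Nat.one_pos).hom g) = reesChartEquiv a ha g := by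
  let E := (Proj.basicOpenIsoAway (reesGrading I) (reesT a ha) (reesT_mem a ha) Nat.one_pos).commRingCatIsoToRingEquiv
  refine ⟨E.symm.trans (reesChartEquiv a ha), fun g => ?_⟩
  rw [RingEquiv.trans_apply]
  congr 1
  exact E.symm_apply_apply g

variable {I a ha}

/-- **Compatibility with the structure maps from the pinning**: `e (π^*(r)|_{D₊(at)}) = r/1` (as N5a
`exists_sectionsEquiv_blowupAlgebra`; `π^* r = awayToSection (r/1)` is `BlowupExit.appLE_π_eq_awayToSection`). [folklore] -/
theorem compat_of_sectionsEquiv_eq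
    (e : Γ(affineBlowup I, Proj.basicOpen (reesGrading I) (reesT a ha)) ≃+* blowupAlgebra I a)
    (he₀ : ∀ g : Away (reesGrading I) (reesT a ha),
      e ((Proj.basicOpenIsoAway (reesGrading I) (reesT a ha) (reesT_mem a ha) Nat.one_pos).hom g) = reesChartEquiv a ha g)
    (r : R) :
    e ((affineBlowup.π I).appLE ⊤ (Proj.basicOpen (reesGrading I) (reesT a ha)) le_top
      ((Scheme.ΓSpecIso (CommRingCat.of R)).inv r)) = algebraMap R (blowupAlgebra I a) r := by
  rw [WildQuotientResolution.BlowupExit.appLE_π_eq_awayToSection (reesT a ha) (reesT_mem a ha) Nat.one_pos le_top r,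
    ← reesChartEquiv_reesChartBase a ha r, ← he₀]
  rfl

/-- **The point reading of the pinned sections isomorphism**: for `y ∈ D₊(at)` and a homogeneous `x ∈ R[It]` of degree `n`,
`e⁻¹(x/(at)ⁿ) ∈ 𝔭_y ↔ x ∈ y` (`𝔭_y = primeIdealOf y ⊆ Γ(Bl, D₊(at))`; the tree's `Proj.mk_mem_basicOpenToSpec_apply` read through
`primeIdealOf = toSpecΓ` and `basicOpenToSpec = toSpecΓ ≫ Spec (awayToSection)`). [folklore] -/
theorem symm_mk_mem_primeIdealOf_iff
    (e : Γ(affineBlowup I, Proj.basicOpen (reesGrading I) (reesT a ha)) ≃+* blowupAlgebra I a)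
    (he₀ : ∀ g : Away (reesGrading I) (reesT a ha),
      e ((Proj.basicOpenIsoAway (reesGrading I) (reesT a ha) (reesT_mem a ha) Nat.one_pos).hom g) = reesChartEquiv a ha g)
    (y : ↥(affineBlowup I)) (hy : y ∈ Proj.basicOpen (reesGrading I) (reesT a ha)) (n : ℕ) (x : reesAlgebra I)
    (hx : x ∈ reesGrading I (n • 1)) :
    e.symm (reesChartEquiv a ha (HomogeneousLocalization.Away.mk (reesGrading I) (reesT_mem a ha) n x hx)) ∈
        ((⟨Proj.basicOpen (reesGrading I) (reesT a ha), AffineBlowupChartFrame.isAffineOpen_basicOpen_reesT I a ha⟩ :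
          (affineBlowup I).affineOpens).2.primeIdealOf ⟨y, hy⟩).asIdeal ↔
      x ∈ y.asHomogeneousIdeal := by
  set g := HomogeneousLocalization.Away.mk (reesGrading I) (reesT_mem a ha) n x hx with hg
  -- `e⁻¹ (reesChartEquiv g) = (basicOpenIsoAway).hom g`
  have hsymm : e.symm (reesChartEquiv a ha g) =
      (Proj.basicOpenIsoAway (reesGrading I) (reesT a ha) (reesT_mem a ha) Nat.one_pos).hom g := by
    rw [RingEquiv.symm_apply_eq, he₀]
  rw [hsymm]
  -- `𝔭_y = toSpecΓ y`, and `basicOpenToSpec y = Spec (awayToSection) (toSpecΓ y)`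
  have h1 : ((⟨Proj.basicOpen (reesGrading I) (reesT a ha), AffineBlowupChartFrame.isAffineOpen_basicOpen_reesT I a ha⟩ :
      (affineBlowup I).affineOpens).2.primeIdealOf ⟨y, hy⟩) =
        (Proj.basicOpen (reesGrading I) (reesT a ha)).toSpecΓ.base ⟨y, hy⟩ := rfl
  have h2 : Proj.basicOpenToSpec (reesGrading I) (reesT a ha) ⟨y, hy⟩ =
      PrimeSpectrum.comap (Proj.awayToSection (reesGrading I) (reesT a ha)).hom
        ((Proj.basicOpen (reesGrading I) (reesT a ha)).toSpecΓ.base ⟨y, hy⟩) := by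
    rw [Proj.basicOpenToSpec, Scheme.Hom.comp_apply, Spec.map_apply]
  have h3 := Proj.mk_mem_basicOpenToSpec_apply (reesGrading I) (reesT a ha) ⟨y, hy⟩
    ⟨n • 1, ⟨x, hx⟩, ⟨reesT a ha ^ n, SetLike.pow_mem_graded n (reesT_mem a ha)⟩, ⟨n, rfl⟩⟩
  rw [h2, PrimeSpectrum.comap_asIdeal, Ideal.mem_comap] at h3
  rw [h1]
  exact h3

/-- `reesChartEquiv ((bt)/(at)) = b/a` for `b ∈ I` (the tree's `reesChart_mk` with `n = 1`). [folklore] -/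
theorem reesChartEquiv_mk_reesT (b : R) (hb : b ∈ I) :
    reesChartEquiv a ha (HomogeneousLocalization.Away.mk (reesGrading I) (reesT_mem a ha) 1 (reesT b hb)
        (by simpa using reesT_mem b hb)) =
      ⟨algebraMap R (Localization.Away a) b * IsLocalization.Away.invSelf a, div_mem_blowupAlgebra I a hb⟩ := by
  apply Subtype.ext
  rw [coe_reesChartEquiv, reesChart_mk a ha _ (r := b) (by rw [coe_reesT]), pow_one]

/-- **(ii) THE OVERLAP OF TWO REES CHARTS READ THROUGH THE SECTIONS ISOMORPHISM**: for `a, b ∈ I`,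
`(affineBlowup I).basicOpen (e⁻¹(b/a)) = D₊(at) ⊓ D₊(bt)` — the chart `D₊(bt)` meets `D₊(at) = Spec R[I/a]` in the basic open of
`b/a`. (Points: `y ∈ D(e⁻¹(b/a)) ↔ e⁻¹((bt)/(at)) ∉ 𝔭_y ↔ bt ∉ y ↔ y ∈ D₊(bt)` for `y ∈ D₊(at)`, and `D(s) ⊆ D₊(at)`.) With a Bezout
identity `Σ c_τ (x_τ/x_σ) = 1` on the charts meeting `C̄` this is N4′'s `hcover`. [folklore; Stacks 0804] -/
theorem basicOpen_symm_div_eq_inf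
    (e : Γ(affineBlowup I, Proj.basicOpen (reesGrading I) (reesT a ha)) ≃+* blowupAlgebra I a)
    (he₀ : ∀ g : Away (reesGrading I) (reesT a ha),
      e ((Proj.basicOpenIsoAway (reesGrading I) (reesT a ha) (reesT_mem a ha) Nat.one_pos).hom g) = reesChartEquiv a ha g)
    (b : R) (hb : b ∈ I) :
    (affineBlowup I).basicOpen (e.symm ⟨algebraMap R (Localization.Away a) b * IsLocalization.Away.invSelf a,
        div_mem_blowupAlgebra I a hb⟩) =
      Proj.basicOpen (reesGrading I) (reesT a ha) ⊓ Proj.basicOpen (reesGrading I) (reesT b hb) := by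
  rw [← reesChartEquiv_mk_reesT (a := a) (ha := ha) b hb]
  ext y
  constructor
  · intro hyD
    have hy : y ∈ Proj.basicOpen (reesGrading I) (reesT a ha) := (affineBlowup I).basicOpen_le _ hyD
    refine ⟨hy, ?_⟩
    rw [SetLike.mem_coe, Proj.mem_basicOpen]
    exact fun hmem => ((mem_primeIdealOf_iff_not_mem_basicOpen _ hy _).mp
      ((symm_mk_mem_primeIdealOf_iff e he₀ y hy 1 (reesT b hb) (by simpa using reesT_mem b hb)).mpr hmem)) hyD
  · rintro ⟨hy, hyb⟩
    rw [SetLike.mem_coe, Proj.mem_basicOpen] at hyb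
    by_contra hyD
    exact hyb ((symm_mk_mem_primeIdealOf_iff e he₀ y hy 1 (reesT b hb) (by simpa using reesT_mem b hb)).mp
      ((mem_primeIdealOf_iff_not_mem_basicOpen _ hy _).mpr hyD))

/-- The overlap on points: for `y ∈ D₊(at)`, `y ∈ D(e⁻¹(b/a)) ↔ y ∈ D₊(bt)`. [folklore] -/
theorem mem_basicOpen_symm_div_iff
    (e : Γ(affineBlowup I, Proj.basicOpen (reesGrading I) (reesT a ha)) ≃+* blowupAlgebra I a)
    (he₀ : ∀ g : Away (reesGrading I) (reesT a ha),
      e ((Proj.basicOpenIsoAway (reesGrading I) (reesT a ha) (reesT_mem a ha) Nat.one_pos).hom g) = reesChartEquiv a ha g)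
    (b : R) (hb : b ∈ I) (y : ↥(affineBlowup I)) (hy : y ∈ Proj.basicOpen (reesGrading I) (reesT a ha)) :
    y ∈ (affineBlowup I).basicOpen (e.symm ⟨algebraMap R (Localization.Away a) b * IsLocalization.Away.invSelf a,
        div_mem_blowupAlgebra I a hb⟩) ↔
      y ∈ Proj.basicOpen (reesGrading I) (reesT b hb) := by
  rw [basicOpen_symm_div_eq_inf e he₀ b hb]
  exact ⟨fun h => h.2, fun h => ⟨hy, h⟩⟩

/-- `J(U) ≤ 𝔭_x ↔ x ∈ supp J` for an ideal sheaf `J` and a point `x` of an affine open `U` (any scheme; Mathlib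
`Scheme.IdealSheafData.mem_support_iff_of_mem` + `s ∈ 𝔭_x ↔ x ∉ D(s)`). [folklore] -/
theorem ideal_le_primeIdealOf_iff_mem_support {X : Scheme.{u}} (U : X.affineOpens) {x : X} (hx : x ∈ (U : X.Opens))
    (J : X.IdealSheafData) : J.ideal U ≤ (U.2.primeIdealOf ⟨x, hx⟩).asIdeal ↔ x ∈ J.support := by
  rw [Scheme.IdealSheafData.mem_support_iff_of_mem (I := J) (U := U) hx, Scheme.mem_zeroLocus_iff]
  exact ⟨fun h s hs => (mem_primeIdealOf_iff_not_mem_basicOpen U hx s).mp (h hs),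
    fun h s hs => (mem_primeIdealOf_iff_not_mem_basicOpen U hx s).mpr (h s hs)⟩

/-- **FROM A BEZOUT CERTIFICATE TO THE COVER** (the cert's `cover_certificates` ⇒ N4′'s `hcover`): `y ∈ D₊(at)`, elements
`b_i ∈ I`, and an ideal `P′ ⊆ Γ(Bl, D₊(at))` in the prime of `y` (e.g. `P′ = J₂.ideal D₊(at)` for `y ∈ supp J₂`) such that the `b_i/a`
together with `P′·e` generate `R[I/a]`: then `y ∈ D₊(b_i t)` for some `i` (if every `e⁻¹(b_i/a)` lay in `𝔭_y`, so would
`e⁻¹(R[I/a]) = Γ`). [folklore] -/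
theorem exists_mem_basicOpen_of_span_sup_map_eq_top
    (e : Γ(affineBlowup I, Proj.basicOpen (reesGrading I) (reesT a ha)) ≃+* blowupAlgebra I a)
    (he₀ : ∀ g : Away (reesGrading I) (reesT a ha),
      e ((Proj.basicOpenIsoAway (reesGrading I) (reesT a ha) (reesT_mem a ha) Nat.one_pos).hom g) = reesChartEquiv a ha g)
    (y : ↥(affineBlowup I)) (hy : y ∈ Proj.basicOpen (reesGrading I) (reesT a ha)) {m : ℕ} (b : Fin m → R) (hb : ∀ i, b i ∈ I)
    (P' : Ideal Γ(affineBlowup I, Proj.basicOpen (reesGrading I) (reesT a ha)))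
    (hP'y : P' ≤ ((⟨Proj.basicOpen (reesGrading I) (reesT a ha), AffineBlowupChartFrame.isAffineOpen_basicOpen_reesT I a ha⟩ :
      (affineBlowup I).affineOpens).2.primeIdealOf ⟨y, hy⟩).asIdeal)
    (hsup : Ideal.span (Set.range fun i : Fin m => (⟨algebraMap R (Localization.Away a) (b i) * IsLocalization.Away.invSelf a,
        div_mem_blowupAlgebra I a (hb i)⟩ : blowupAlgebra I a)) ⊔ P'.map e = ⊤) :
    ∃ i : Fin m, y ∈ Proj.basicOpen (reesGrading I) (reesT (b i) (hb i)) := by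
  by_contra hcon
  push Not at hcon
  set 𝔭 := ((⟨Proj.basicOpen (reesGrading I) (reesT a ha), AffineBlowupChartFrame.isAffineOpen_basicOpen_reesT I a ha⟩ :
      (affineBlowup I).affineOpens).2.primeIdealOf ⟨y, hy⟩) with h𝔭
  -- every `b_i/a` lies in `𝔭_y·e`, and so does `P′·e`: hence `⊤ ≤ 𝔭_y·e`
  have hle : (⊤ : Ideal (blowupAlgebra I a)) ≤ 𝔭.asIdeal.map e := by
    rw [← hsup, sup_le_iff, Ideal.span_le]
    refine ⟨?_, Ideal.map_mono hP'y⟩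
    rintro _ ⟨i, rfl⟩
    have h1 : e.symm ⟨algebraMap R (Localization.Away a) (b i) * IsLocalization.Away.invSelf a, div_mem_blowupAlgebra I a (hb i)⟩ ∈
        𝔭.asIdeal :=
      (mem_primeIdealOf_iff_not_mem_basicOpen _ hy _).mpr fun h => hcon i ((mem_basicOpen_symm_div_iff e he₀ (b i) (hb i) y hy).mp h)
    have h2 := Ideal.mem_map_of_mem e h1
    rwa [RingEquiv.apply_symm_apply] at h2
  haveI : (𝔭.asIdeal.map e).IsPrime := Ideal.map_isPrime_of_equiv e
  exact (inferInstance : (𝔭.asIdeal.map e).IsPrime).ne_top (top_le_iff.mp hle)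

/-- The same with the level-2 centre as an IDEAL SHEAF `J` (e.g. `𝓘(C̄)` of N1): for `y ∈ supp J ∩ D₊(at)` and a Bezout certificate
`(b_i/a)_i + (J.ideal D₊(at))·e = R[I/a]`, `y ∈ D₊(b_i t)` for some `i` — N4′'s `hcover` for the charts `D₊(b_i t)` through `C̄`. [folklore] -/
theorem exists_mem_basicOpen_of_mem_support
    (e : Γ(affineBlowup I, Proj.basicOpen (reesGrading I) (reesT a ha)) ≃+* blowupAlgebra I a)
    (he₀ : ∀ g : Away (reesGrading I) (reesT a ha),
      e ((Proj.basicOpenIsoAway (reesGrading I) (reesT a ha) (reesT_mem a ha) Nat.one_pos).hom g) = reesChartEquiv a ha g)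
    (J : (affineBlowup I).IdealSheafData) (y : ↥(affineBlowup I)) (hy : y ∈ Proj.basicOpen (reesGrading I) (reesT a ha))
    (hyJ : y ∈ J.support) {m : ℕ} (b : Fin m → R) (hb : ∀ i, b i ∈ I)
    (hsup : Ideal.span (Set.range fun i : Fin m => (⟨algebraMap R (Localization.Away a) (b i) * IsLocalization.Away.invSelf a,
        div_mem_blowupAlgebra I a (hb i)⟩ : blowupAlgebra I a)) ⊔
      (J.ideal ⟨Proj.basicOpen (reesGrading I) (reesT a ha), AffineBlowupChartFrame.isAffineOpen_basicOpen_reesT I a ha⟩).map e = ⊤) :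
    ∃ i : Fin m, y ∈ Proj.basicOpen (reesGrading I) (reesT (b i) (hb i)) :=
  exists_mem_basicOpen_of_span_sup_map_eq_top e he₀ y hy b hb _
    ((ideal_le_primeIdealOf_iff_mem_support _ hy J).mpr hyJ) hsup

end ReesChart

/-! ## §3 (iii) The fibre ideal of a base point read in `R[I/a]` -/

section FibreIdeal

variable {R : Type} [CommRing R] (I : Ideal R) (a : R) (ha : a ∈ I)

/-- **(iii) `(𝔭_b·Γ(Bl, D₊(at)))·e = 𝔭_b·R[I/a]`**: the N4b fibre ideal of a base point `b ∈ Spec R` on the chart `D₊(at)` (the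
extension of `𝔭_b ⊆ Γ(Spec R, ⊤)` along `π.appLE ⊤ D₊(at)`, `FibreIdealOfBasePoint`) goes under ANY `R`-compatible sections isomorphism
`e` (N5a `exists_sectionsEquiv_blowupAlgebra`, or §2) to the extension of `b` along `R → R[I/a]` (`𝔭_b = b·Γ(Spec R, ⊤)` is res-type-002's
`FibreIdealOfOrigin.primeIdealOf_top_asIdeal`). [folklore] -/
theorem map_fibreIdeal_eq
    (e : Γ(affineBlowup I, Proj.basicOpen (reesGrading I) (reesT a ha)) ≃+* blowupAlgebra I a)
    (he : ∀ r : R, e ((affineBlowup.π I).appLE ⊤ (Proj.basicOpen (reesGrading I) (reesT a ha)) le_top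
      ((Scheme.ΓSpecIso (CommRingCat.of R)).inv r)) = algebraMap R (blowupAlgebra I a) r)
    (b : ↥(Spec (CommRingCat.of R)))
    (hb : b ∈ ((⟨⊤, isAffineOpen_top (Spec (CommRingCat.of R))⟩ : (Spec (CommRingCat.of R)).affineOpens) :
      (Spec (CommRingCat.of R)).Opens)) :
    (((⟨⊤, isAffineOpen_top (Spec (CommRingCat.of R))⟩ : (Spec (CommRingCat.of R)).affineOpens).2.primeIdealOf
        ⟨b, hb⟩).asIdeal.map ((affineBlowup.π I).appLE
          ((⟨⊤, isAffineOpen_top (Spec (CommRingCat.of R))⟩ : (Spec (CommRingCat.of R)).affineOpens) :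
            (Spec (CommRingCat.of R)).Opens) (Proj.basicOpen (reesGrading I) (reesT a ha)) le_top).hom).map e =
      b.asIdeal.map (algebraMap R (blowupAlgebra I a)) := by
  rw [FibreIdealOfOrigin.primeIdealOf_top_asIdeal (CommRingCat.of R) b hb, Ideal.map_map]
  have hfac : (e : Γ(affineBlowup I, Proj.basicOpen (reesGrading I) (reesT a ha)) →+* blowupAlgebra I a).comp
      (((affineBlowup.π I).appLE ((⟨⊤, isAffineOpen_top (Spec (CommRingCat.of R))⟩ :
        (Spec (CommRingCat.of R)).affineOpens) : (Spec (CommRingCat.of R)).Opens)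
          (Proj.basicOpen (reesGrading I) (reesT a ha)) le_top).hom.comp (Scheme.ΓSpecIso (CommRingCat.of R)).inv.hom) =
      algebraMap R (blowupAlgebra I a) :=
    RingHom.ext fun r => he r
  rw [← hfac, ← Ideal.map_map (g := (e : Γ(affineBlowup I, Proj.basicOpen (reesGrading I) (reesT a ha)) →+* blowupAlgebra I a))]
  rfl

/-- **Generators form**: if `b = (x_j)_j` then `(𝔭_b·Γ(Bl, D₊(at)))·e = (x_j/1)_j ⊆ R[I/a]` (N4c `map_primeIdealOf_top_eq_span` read in
`R[I/a]`; for the T₁₁/3 origin these are the images of the coordinates, the `hXQ` currency of the CN engine). [folklore] -/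
theorem map_fibreIdeal_eq_span
    (e : Γ(affineBlowup I, Proj.basicOpen (reesGrading I) (reesT a ha)) ≃+* blowupAlgebra I a)
    (he : ∀ r : R, e ((affineBlowup.π I).appLE ⊤ (Proj.basicOpen (reesGrading I) (reesT a ha)) le_top
      ((Scheme.ΓSpecIso (CommRingCat.of R)).inv r)) = algebraMap R (blowupAlgebra I a) r)
    {ι : Type} (x : ι → R) (b : ↥(Spec (CommRingCat.of R))) (hb0 : b.asIdeal = Ideal.span (Set.range x))
    (hb : b ∈ ((⟨⊤, isAffineOpen_top (Spec (CommRingCat.of R))⟩ : (Spec (CommRingCat.of R)).affineOpens) :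
      (Spec (CommRingCat.of R)).Opens)) :
    (((⟨⊤, isAffineOpen_top (Spec (CommRingCat.of R))⟩ : (Spec (CommRingCat.of R)).affineOpens).2.primeIdealOf
        ⟨b, hb⟩).asIdeal.map ((affineBlowup.π I).appLE
          ((⟨⊤, isAffineOpen_top (Spec (CommRingCat.of R))⟩ : (Spec (CommRingCat.of R)).affineOpens) :
            (Spec (CommRingCat.of R)).Opens) (Proj.basicOpen (reesGrading I) (reesT a ha)) le_top).hom).map e =
      Ideal.span (Set.range fun j : ι => algebraMap R (blowupAlgebra I a) (x j)) := by
  rw [map_fibreIdeal_eq I a ha e he b hb, hb0, Ideal.map_span, ← Set.range_comp]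
  rfl

end FibreIdeal

end Summit.ResolutionOfSingularities.ResolutionOfSingularities.Theorems.FInjectiveMacaulayfication.AffineBlowupChartTransport

end
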